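import Literature.NumberTheory.LFunctions.WeilTwoPrimePos59Def
import Literature.NumberTheory.LFunctions.WeilTwoPrimeOddMarginEDataP6
import Literature.NumberTheory.LFunctions.WeilBlockRowsPZ
import Literature.NumberTheory.LFunctions.WeilTwoPrimeOddMarginEDataDn2
import HarnessLib

/-!
# Two-prime positivity certificate (a₀ = 59/100): dominance of `R = S'(κ) − UᵀU`, block 1, rows 60–64

Kernel facts by `decide +kernel`, one declaration per row. Pure proof file.
-/

noncomputable section

namespace Literature.NumberTheory.LFunctions

set_option maxHeartbeats 0 in
/-- dominance of `R = S'(κ) − UᵀU`, block 1, row 60 (positivity certificate). [folklore] -/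
theorem checkDomRowPZ1_60_weilCert23P : weilCert23PBase.checkDomRowPZ weilCert23EPm weilCert23EDn weilCert23ELs weilCert23EHp weilCert23EKappaLit 1 60 = true := by
  decide +kernel

set_option maxHeartbeats 0 in
/-- dominance of `R = S'(κ) − UᵀU`, block 1, row 61 (positivity certificate). [folklore] -/
theorem checkDomRowPZ1_61_weilCert23P : weilCert23PBase.checkDomRowPZ weilCert23EPm weilCert23EDn weilCert23ELs weilCert23EHp weilCert23EKappaLit 1 61 = true := by
  decide +kernel

set_option maxHeartbeats 0 in
/-- dominance of `R = S'(κ) − UᵀU`, block 1, row 62 (positivity certificate). [folklore] -/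
theorem checkDomRowPZ1_62_weilCert23P : weilCert23PBase.checkDomRowPZ weilCert23EPm weilCert23EDn weilCert23ELs weilCert23EHp weilCert23EKappaLit 1 62 = true := by
  decide +kernel

set_option maxHeartbeats 0 in
/-- dominance of `R = S'(κ) − UᵀU`, block 1, row 63 (positivity certificate). [folklore] -/
theorem checkDomRowPZ1_63_weilCert23P : weilCert23PBase.checkDomRowPZ weilCert23EPm weilCert23EDn weilCert23ELs weilCert23EHp weilCert23EKappaLit 1 63 = true := by
  decide +kernel

set_option maxHeartbeats 0 in
/-- dominance of `R = S'(κ) − UᵀU`, block 1, row 64 (positivity certificate). [folklore] -/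
theorem checkDomRowPZ1_64_weilCert23P : weilCert23PBase.checkDomRowPZ weilCert23EPm weilCert23EDn weilCert23ELs weilCert23EHp weilCert23EKappaLit 1 64 = true := by
  decide +kernel


end Literature.NumberTheory.LFunctions
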